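/-
Copyright: the b2b-balaban cell (near-miss cell 7), T⁴-continuum fan-out; row NE7b ROUND-2 swarm, seat
t4-ne7b-formalise-leaf-03 (row S12 «ASSEMBLY» of `t4/b2b-balaban-t4-ne7b-p1/LEAVES-NE7b.md`; node A12 of the typer's
`t4/formal/NE7b/DAG.md`).  Released under the licence of the surrounding project.
-/
import Summits.QuantumFields.BalabanUV.T4Continuum.Support.HistoryAssemblyTermsLE
import Summits.QuantumFields.BalabanUV.T4Continuum.Support.HistoryAssemblyPedigree
import Summits.QuantumFields.BalabanUV.T4Continuum.Support.HistoryGenTimedLE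

/-!
# History assembly, LE currency: terms read as pedigrees WITHOUT the renewal-at-reach clause, and the END

Summits-side support file of the T⁴-continuum cell (rung (B)+1 on a FINITE torus only; NOT infinite volume, NOT the
mass gap, NOT the Clay statement; NOT a proof of the spine estimate NE7b).  Row S12 «ASSEMBLY» of the ROUND-2 swarm
table `t4/b2b-balaban-t4-ne7b-p1/LEAVES-NE7b.md`, node A12-I of the typer's `t4/formal/NE7b/DAG.md`; the typer's
«LE consumer switch», pedigree layer (the sibling of `HistoryAssemblyPedigree` over `HistoryAssemblyTermsLE`): after
it `RenewAtReach` has DISAPPEARED from the END's hypotheses (typer T-NE7b-5, LEAVES v2.3 row S4c).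

WHAT.  §1 **`structure PedigreeReadingLE`** = `HistoryAssemblyPedigree.PedigreeReading` with `timed` over leaf-02's
`HistoryGenTimedLE.TimedLE` (cutoff `step ≤ K`, `renew_step`, renewal no later than the booked reach `step ≤ reach`,
`alive`; NO renewal-at-reach EQUALITY); `forest`, `headOldest`, `pending`, `cell_mem`, `cell_inj` verbatim.
§2 **`termReadingLE_of_pedigreeLE`**: the LE term reading of `HistoryAssemblyTermsLE` for the member map
`HistoryAssemblyPedigree.memOf` (caps read off the data, `HistoryCaps`): `consistent` by leaf-02's `consistentTLE_genT`,
`wf` by `wfLE_genT` (forest + oldest-line-first + `TimedLE`), `chrono` by leaf-09's `Pedigree.chronoC_genT`, the rest as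
in `termReading_of_pedigree`.  §3 the END **`hybridNE7_of_pedigreeReadingLE_canon`** =
`HistoryAssemblyPedigree.hybridNE7_of_pedigreeReading_canon` VERBATIM except `H : PedigreeReadingLE …` and
`hir : irThresholdTLE C F.L rr β₀ ≤ log g⁻²` (constants only), composed over
`HistoryAssemblyTermsLE.hybridNE7_of_termReadingLE_canon`.  [folklore] finite bookkeeping + composition of landed lemmas
by name; ONE new `structure … : Prop` (hypothesis shape, trigger condition c1); no `[cite:]` tag, nothing printed
asserted.

HONEST DEPENDENCY (cell): continuum YM on T⁴ ⇐ BetaPertH ∧ nine spine estimates (0/9 proved); BetaPertH ⇐ (D1) ∧ (D4)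
∧ CAP+tail.  Nothing of H3 ∕ (B) ∕ BetaPertH is discharged here; NE7b is NOT proved; no date.
-/

open Finset MeasureTheory
open Literature.MathematicalPhysics.QuantumFieldTheory.Balaban1983to89
open T4PersistenceDictionary T4PersistentHistoryCount T4BankedInduction T4PrintedShapeBanking
open T4WeightBudget T4GlobalDenominator T4LiveClassFibration T4LiveStructureGas T4LiveGasToTerms T4RecordPriceSeam
open T4PartnerMultiplicity T4IndicatorShell T4MatchingAssembly T4MatchingClosure T4MatchingClosureSocket T4Continuum
open T4StabilitySocket T4BranchingRecordsGas T4TaggedShapeBanking T4CanonicalMenus T4RenewalChains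
open Summit.QuantumFields.BalabanUV.T4Continuum.PlacementBatch
open Summit.QuantumFields.BalabanUV.T4Continuum.PlacementSkeleton
open Summit.QuantumFields.BalabanUV.T4Continuum.CountThresholdUniform
open Summit.QuantumFields.BalabanUV.T4Continuum.CountThresholdExit
open Summit.QuantumFields.BalabanUV.T4Continuum.CountSeamJunction
open Summit.QuantumFields.BalabanUV.T4Continuum.LateMergers
open Summit.QuantumFields.BalabanUV.T4Continuum.HistoryFlow
open Summit.QuantumFields.BalabanUV.T4Continuum.HistoryRegeneration
open Summit.QuantumFields.BalabanUV.T4Continuum.HistoryTables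
open Summit.QuantumFields.BalabanUV.T4Continuum.HistoryAssemblyTrees
open Summit.QuantumFields.BalabanUV.T4Continuum.HistorySocketTH
open Summit.QuantumFields.BalabanUV.T4Continuum.HistoryAssemblyTerms
open Summit.QuantumFields.BalabanUV.T4Continuum.HistoryGen
open Summit.QuantumFields.BalabanUV.T4Continuum.HistoryCaps
open Summit.QuantumFields.BalabanUV.T4Continuum.HistoryAssemblyPedigree
open Summit.QuantumFields.BalabanUV.T4Continuum.HistoryBankingLE
open Summit.QuantumFields.BalabanUV.T4Continuum.HistoryExitLE
open Summit.QuantumFields.BalabanUV.T4Continuum.HistoryGenTimedLE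
open Summit.QuantumFields.BalabanUV.T4Continuum.HistoryAssemblyTreesLE
open Summit.QuantumFields.BalabanUV.T4Continuum.HistoryAssemblyTermsLE

namespace Summit.QuantumFields.BalabanUV.T4Continuum.HistoryAssemblyPedigreeLE

noncomputable section

/-! ## §1 Terms read as pedigrees, LE timing -/

section Reading

variable {ι α π γ : Type*} [DecidableEq α] [DecidableEq π] [DecidableEq γ]

/-- **THE PER-TERM READING AS PEDIGREES, LE TIMING** (= `HistoryAssemblyPedigree.PedigreeReading` with `timed` over
leaf-02's `TimedLE`: every component born no later than the cutoff; renewals of previous-step components NO LATER than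
the booked reach; old parts of a join alive at the join step — NO renewal-at-reach equality), a FOREST, OLDEST LINE
FIRST; live components PENDING at the cutoff, root cells of the root's age, distinct live components at distinct root
cells. [folklore] -/
structure PedigreeReadingLE (C : T4PrintedShapeBanking.Consts) (Cell : ℕ → ℕ → Finset γ) (K₀ : ℕ) (R : ℕ → ℕ → ℕ)
    (T : ℕ → Finset ι) (ped : ℕ → ι → Pedigree α π) (liveC : ℕ → ι → Finset α) (cellOf : ℕ → ι → α → γ) :
    Prop where
  /-- the pedigree is LE-timed for the run's table (cutoff, `renew_step`, renewal no later than the reach, `alive`) -/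
  timed : ∀ K, K₀ ≤ K → ∀ τ ∈ T K, TimedLE (ped K τ) K (dictWT Prod.fst (R K) C.n₁)
  /-- the pedigree is a forest -/
  forest : ∀ K, K₀ ≤ K → ∀ τ ∈ T K, ∀ c, (ped K τ).Forest c
  /-- oldest line first at every component -/
  headOldest : ∀ K, K₀ ≤ K → ∀ τ ∈ T K, ∀ c, (ped K τ).HeadOldest c
  /-- live components are pending at the cutoff -/
  pending : ∀ K, K₀ ≤ K → ∀ τ ∈ T K, ∀ c ∈ liveC K τ, K < ((ped K τ).genT c).reach (dictWT Prod.fst (R K) C.n₁)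
  /-- the root cell of a live component is a cell of the root's age -/
  cell_mem : ∀ K, K₀ ≤ K → ∀ τ ∈ T K, ∀ c ∈ liveC K τ, cellOf K τ c ∈ Cell K (K - ((ped K τ).genT c).rootStep)
  /-- distinct live components of one term have distinct root cells -/
  cell_inj : ∀ K, K₀ ≤ K → ∀ τ ∈ T K, Set.InjOn (cellOf K τ) (liveC K τ : Set α)

end Reading

/-! ## §2 The LE pedigree reading gives the LE term reading (caps read off the data) -/

section ToTerms

variable {ι α π γ : Type*} [DecidableEq α] [DecidableEq π] [DecidableEq γ]
  {C : T4PrintedShapeBanking.Consts} {Cell : ℕ → ℕ → Finset γ} {K₀ : ℕ} {R : ℕ → ℕ → ℕ} {T : ℕ → Finset ι}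
  {ped : ℕ → ι → Pedigree α π} {liveC : ℕ → ι → Finset α} {cellOf : ℕ → ι → α → γ}

/-- **THE LE PEDIGREE READING GIVES THE LE TERM READING** for the member map `memOf`, caps `dcapOf`∕`ncapOf` read off
the data, any matching scale: `consistent` by leaf-02's `consistentTLE_genT`, `wf` by `wfLE_genT`, `chrono` by
`Pedigree.chronoC_genT` (row S3), `fat_lt`∕`fuel_le` by `HistoryCaps` (row S5), `pending`∕`cell_mem` from the reading,
`inj` from distinct root cells. [folklore] -/
theorem termReadingLE_of_pedigreeLE (H : PedigreeReadingLE C Cell K₀ R T ped liveC cellOf) (jstar : ℕ → ℕ) :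
    TermReadingLE Prod.fst C Cell (dcapOf Prod.fst T (memOf ped liveC cellOf)) (ncapOf T (memOf ped liveC cellOf))
      jstar K₀ R T (memOf ped liveC cellOf) where
  consistent K hK τ hτ q hq := by
    obtain ⟨c, -, rfl⟩ := mem_memOf.1 hq
    exact consistentTLE_genT (H.timed K hK τ (mem_badTerms.1 hτ).1) c
  wf K hK τ hτ q hq := by
    obtain ⟨c, -, rfl⟩ := mem_memOf.1 hq
    exact wfLE_genT (H.forest K hK τ (mem_badTerms.1 hτ).1) (H.headOldest K hK τ (mem_badTerms.1 hτ).1)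
      (H.timed K hK τ (mem_badTerms.1 hτ).1) c
  pending K hK τ hτ q hq := by
    obtain ⟨c, hc, rfl⟩ := mem_memOf.1 hq
    exact H.pending K hK τ (mem_badTerms.1 hτ).1 c hc
  cell_mem K hK τ hτ q hq := by
    obtain ⟨c, hc, rfl⟩ := mem_memOf.1 hq
    exact H.cell_mem K hK τ (mem_badTerms.1 hτ).1 c hc
  chrono K hK τ hτ q hq := by
    obtain ⟨c, -, rfl⟩ := mem_memOf.1 hq
    exact Pedigree.chronoC_genT (H.headOldest K hK τ (mem_badTerms.1 hτ).1) c
  fat_lt K hK τ hτ q hq e he hk :=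
    fat_lt_of_mem Prod.fst T (memOf ped liveC cellOf) K₀ K hK τ (mem_badTerms.1 hτ).1 q hq e he hk
  fuel_le K hK τ hτ q hq := fuel_le_of_mem T (memOf ped liveC cellOf) K₀ K hK τ (mem_badTerms.1 hτ).1 q hq
  inj K hK τ hτ := by
    intro q hq q' hq' hs
    obtain ⟨c, hc, rfl⟩ := mem_memOf.1 (Finset.mem_coe.1 hq)
    obtain ⟨c', hc', rfl⟩ := mem_memOf.1 (Finset.mem_coe.1 hq')
    have hcell : cellOf K τ c = cellOf K τ c' := by
      have := congrArg (fun s : BSlot γ PEv => s.2.1) hs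
      simpa [bslotOf] using this
    have hcc : c = c' := H.cell_inj K hK τ (mem_badTerms.1 hτ).1 (Finset.mem_coe.2 hc) (Finset.mem_coe.2 hc') hcell
    subst hcc
    rfl

end ToTerms

/-! ## §3 The END: NE7b's COUNT exit (LE) and seam with the live structures read as pedigrees -/

section End

variable {F : T4Family} {G : Type*} [GaugeGroup G] [MeasurableSpace G] [HaarData G] [RegularGaugeGroup G]
variable {α π : Type*} [DecidableEq α] [DecidableEq π]
variable {ι : Type*} [DecidableEq ι] {l₀ vol : ℝ} {K₀ : ℕ} {T : ℕ → Finset ι} {A A' shA shB : ℕ → ℝ → ι → ℝ}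
  {dead dead' : ℕ → ℝ → ι → ℝ} {nup mup : ℕ → ℝ → ℝ} {Nup : ℝ}
  {Cc Rr CcRec RrRec : ℕ → ℝ → ι → ℝ} {ν u s₂ q₀ r s Wsh : ℕ → ℝ}

/-- **NE7b's COUNT EXIT WITH THE LIVE STRUCTURES READ AS PEDIGREES, LE CURRENCY — NO `RenewAtReach`.**
`HistoryAssemblyPedigree.hybridNE7_of_pedigreeReading_canon` VERBATIM except `H : PedigreeReadingLE …` and
`hir : irThresholdTLE C F.L rr β₀ ≤ log g⁻²`; composed over `HistoryAssemblyTermsLE.hybridNE7_of_termReadingLE_canon` with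
the term reading SUPPLIED by `termReadingLE_of_pedigreeLE`.  Displayed: the reading map `ped`∕`liveC`∕`cellOf` +
`PedigreeReadingLE`; the per-term price readings; the `Regeneration` numerator fields per run over the classes
`bstrOf Prod.fst (memOf …)` ∕ `badClasses …`; constants + two largeness conditions; flow side; tuning; the (2.5) side
condition; the (B) side; the seam data. [folklore] -/
theorem hybridNE7_of_pedigreeReadingLE_canon (D : FiniteEpsData F G) {C : T4PrintedShapeBanking.Consts}
    {rr : ℕ} {β₀ : ℝ} (h : ThresholdOK C F.L rr β₀) (hμ : 0 < C.μ) (d n : ℕ)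
    (hκ₁ : (d : ℝ) * Real.log F.L + 2 * Real.log 2 ≤ C.κ₁) (hE₀ : Real.log (2 + birthMass C) ≤ C.E₀)
    -- the flow side (⇐ BetaPertH, displayed) and tuning
    {γ₀ γb b β' : ℝ} {pe : ℕ} (hb : 0 ≤ b) (hlo : FlowStep.BetaLowerH b γ₀ D.βfun)
    (hhi : FlowStep.BetaUpperH β' γ₀ D.βfun) (hγ : γb ≤ γ₀) (hγβ : γb ^ 2 * β' < 1)
    (S : B14FlowStep.SmallnessFor γb β' β₀ F.L pe) (hp₀ : C.p₀ ≤ pe) (hrr : rr ≤ pe)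
    {g : ℝ} {g₀ : ℕ → ℝ} (ht : D.Tuned γb g g₀)
    (hir : irThresholdTLE C F.L rr β₀ ≤ Real.log (g ^ 2)⁻¹)
    -- the (B) side
    (hsign : B16.SignConventions D.C) {γB : ℝ} {em ep : ℝ → ℝ} (hcor : B16.Cor3With D.C γB em ep) (hγB : γb ≤ γB)
    {obs : (K : ℕ) → GaugeField (F.P K) 0 G → ℝ} {B : ℝ}
    (hobs : ∀ K, Measurable (obs K)) (hbd : ∀ K U, |obs K U| ≤ B)
    (hα : ∀ K t, |t| ≤ l₀ → K₀ ≤ K →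
      ∫ U, Real.exp (t * obs K U) * D.dens K (g₀ K) 0 U ∂fieldMeasure (F.P K) 0 G ≤ ∑ τ ∈ T K, A K t τ)
    (hα' : ∀ K t, |t| ≤ l₀ → K₀ ≤ K →
      ∫ U, Real.exp (t * obs (K + 1) U) * D.dens (K + 1) (g₀ (K + 1)) 0 U ∂fieldMeasure (F.P (K + 1)) 0 G ≤
        ∑ τ ∈ T K, A' K t τ)
    {c₀ n₁ : ℝ} (hc₀ : 0 < c₀) (hfloor : ∀ K, K₀ ≤ K → c₀ ≤ smallFieldMass D K (g₀ K))
    (hfloor' : ∀ K, K₀ ≤ K → c₀ ≤ smallFieldMass D (K + 1) (g₀ (K + 1)))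
    (hsites : ∀ K, K₀ ≤ K → ((D.C ⟨K, F.m, g₀ K⟩).numSites K : ℝ) ≤ n₁)
    (hsites' : ∀ K, K₀ ≤ K → ((D.C ⟨K + 1, F.m, g₀ (K + 1)⟩).numSites (K + 1) : ℝ) ≤ n₁)
    (hNup : 0 ≤ Nup) (hnup : ∀ K t, |t| ≤ l₀ → K₀ ≤ K → 0 ≤ nup K t ∧ nup K t ≤ Nup)
    (hmup : ∀ K t, |t| ≤ l₀ → K₀ ≤ K → 0 ≤ mup K t ∧ mup K t ≤ Nup)
    -- the (2.5) side condition on the size function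
    (R : ℕ → ℕ → ℕ) (hR : ∀ K s, s ≤ K → B14.IsRj F.L rr ((D.C ⟨K, F.m, g₀ K⟩).flow.g s) (R K s))
    -- H3: the terms read as PEDIGREES of live components with root cells, and their reading
    (ped : ℕ → ι → Pedigree α π) (liveC : ℕ → ι → Finset α) (cellOf : ℕ → ι → α → (Fin d → ℕ))
    (H : PedigreeReadingLE C (cellN d n F.L) K₀ R T ped liveC cellOf)
    {Fc Rf Fc' Rf' : ℕ → Finset (BSlot (Fin d → ℕ) PEv) → ℝ}
    (hprice : ∀ K t, |t| ≤ l₀ → K₀ ≤ K → ∀ τ ∈ badTerms (memOf ped liveC cellOf) jhalf T K,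
      Fc K (bstrOf Prod.fst (memOf ped liveC cellOf) K τ) * Rf K (bstrOf Prod.fst (memOf ped liveC cellOf) K τ) ≤
        ∏ q ∈ memOf ped liveC cellOf K τ,
          priceT Prod.fst C ((F.L : ℝ) ^ d) R (fun K => (D.C ⟨K, F.m, g₀ K⟩).flow.g) K q)
    (hprice' : ∀ K t, |t| ≤ l₀ → K₀ ≤ K → ∀ τ ∈ badTerms (memOf ped liveC cellOf) jhalf T K,
      Fc' K (bstrOf Prod.fst (memOf ped liveC cellOf) K τ) * Rf' K (bstrOf Prod.fst (memOf ped liveC cellOf) K τ) ≤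
        ∏ q ∈ memOf ped liveC cellOf K τ,
          priceT Prod.fst C ((F.L : ℝ) ^ d) R (fun K => (D.C ⟨K, F.m, g₀ K⟩).flow.g) K q)
    -- H3: the remaining `Regeneration` numerator readings, over the classes of the terms
    (up : ∀ K t, |t| ≤ l₀ → K₀ ≤ K → ∀ c ∈ badClasses Prod.fst (memOf ped liveC cellOf) jhalf T K,
      ∀ τ ∈ fibre (bstrOf Prod.fst (memOf ped liveC cellOf)) T K c, A K t τ ≤ dead K t τ * Fc K c * nup K t)
    (dead_nonneg : ∀ K t, |t| ≤ l₀ → K₀ ≤ K → ∀ c ∈ badClasses Prod.fst (memOf ped liveC cellOf) jhalf T K,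
      ∀ τ ∈ fibre (bstrOf Prod.fst (memOf ped liveC cellOf)) T K c, 0 ≤ dead K t τ)
    (resum : ∀ K t, |t| ≤ l₀ → K₀ ≤ K → ∀ c ∈ badClasses Prod.fst (memOf ped liveC cellOf) jhalf T K,
      ∑ τ ∈ fibre (bstrOf Prod.fst (memOf ped liveC cellOf)) T K c, dead K t τ ≤ Rf K c)
    (F_nonneg : ∀ K t, |t| ≤ l₀ → K₀ ≤ K → ∀ c ∈ badClasses Prod.fst (memOf ped liveC cellOf) jhalf T K, 0 ≤ Fc K c)
    (up' : ∀ K t, |t| ≤ l₀ → K₀ ≤ K → ∀ c ∈ badClasses Prod.fst (memOf ped liveC cellOf) jhalf T K,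
      ∀ τ ∈ fibre (bstrOf Prod.fst (memOf ped liveC cellOf)) T K c, A' K t τ ≤ dead' K t τ * Fc' K c * mup K t)
    (dead'_nonneg : ∀ K t, |t| ≤ l₀ → K₀ ≤ K → ∀ c ∈ badClasses Prod.fst (memOf ped liveC cellOf) jhalf T K,
      ∀ τ ∈ fibre (bstrOf Prod.fst (memOf ped liveC cellOf)) T K c, 0 ≤ dead' K t τ)
    (resum' : ∀ K t, |t| ≤ l₀ → K₀ ≤ K → ∀ c ∈ badClasses Prod.fst (memOf ped liveC cellOf) jhalf T K,
      ∑ τ ∈ fibre (bstrOf Prod.fst (memOf ped liveC cellOf)) T K c, dead' K t τ ≤ Rf' K c)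
    (F'_nonneg : ∀ K t, |t| ≤ l₀ → K₀ ≤ K → ∀ c ∈ badClasses Prod.fst (memOf ped liveC cellOf) jhalf T K,
      0 ≤ Fc' K c)
    -- the seam's other inputs
    (hSh : ShellWeightBound l₀ T A A' shA shB Wsh)
    (hTB : ReindexedBudget l₀ vol T (fun K t τ => A K t τ - shA K t τ) (fun K t τ => A' K t τ - shB K t τ)
      (badOfClass (bstrOf Prod.fst (memOf ped liveC cellOf)) T
        (fun K _ => badClasses Prod.fst (memOf ped liveC cellOf) jhalf T K)) Cc Rr CcRec RrRec ν u s₂ q₀ r s)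
    (hr : Summable r) (hu : Summable u) (hs : Summable s) (hs₂ : Summable s₂) :
    ∃ K₁ K₂, K₀ ≤ K₁ ∧ HybridNE7 l₀ vol (fun K => T (K₁ + (K₂ + K))) (fun K => A (K₁ + (K₂ + K)))
      (fun K => A' (K₁ + (K₂ + K)))
      (fun K => badOfClass (bstrOf Prod.fst (memOf ped liveC cellOf)) T
        (fun K _ => badClasses Prod.fst (memOf ped liveC cellOf) jhalf T K) (K₁ + (K₂ + K)))
      (fun K => constOf l₀ B (max (em g) 0) n₁ c₀ Nup *
        recordsBudget (birthMass C) C.κ₁ ((n : ℝ) ^ d) ((F.L : ℝ) ^ d) (Real.log 2) jhalf (K₁ + (K₂ + K)))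
      (fun K => shA (K₁ + (K₂ + K))) (fun K => shB (K₁ + (K₂ + K))) (fun K => Wsh (K₁ + (K₂ + K)))
      (fun K => (r (K₁ + (K₂ + K)) + u (K₁ + (K₂ + K))) + (s (K₁ + (K₂ + K)) + s₂ (K₁ + (K₂ + K)))) :=
  hybridNE7_of_termReadingLE_canon D Prod.fst h hμ d n (dcapOf Prod.fst T (memOf ped liveC cellOf))
    (ncapOf T (memOf ped liveC cellOf)) hκ₁ hE₀ hb hlo hhi hγ hγβ S hp₀ hrr ht hir hsign hcor hγB hobs hbd hα hα' hc₀
    hfloor hfloor' hsites hsites' hNup hnup hmup R hR (memOf ped liveC cellOf) (termReadingLE_of_pedigreeLE H jhalf) hprice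
    hprice' up dead_nonneg resum F_nonneg up' dead'_nonneg resum' F'_nonneg hSh hTB hr hu hs hs₂

end End

end

end Summit.QuantumFields.BalabanUV.T4Continuum.HistoryAssemblyPedigreeLE
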